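import Mathlib.Analysis.InnerProductSpace.PiL2
import Mathlib.Order.Lattice.Nat
import Literature.MathematicalPhysics.StatisticalMechanics.StickyChain
import HarnessLib

/-!
# Sticky hard spheres: unit packings, contact graphs, contact numbers

HONEST FRAMING. This file is part of the venture `Summits/Ventures/Crystal3D` (cell `pub-crystal3d`):
exact contact-graph enumeration + linear programming over local inequalities for sticky-sphere
crystallization. It contains DEFINITIONS and elementary API only. Nothing here is a claim about
three-dimensional crystallization; no theorem of the literature is restated as proved.

## Content (all dimensions `d`)

* `IsUnitPacking x` — a finite labelled configuration `x : Fin N → ℝᵈ` of centres of hard spheres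
  of DIAMETER `1`: distinct centres are at distance `≥ 1`. Two spheres are in CONTACT when their
  centres are at distance exactly `1`. (Bezdek's convention is radius `1` / contact distance `2`;
  the two differ by the scaling `x ↦ 2x` only. Distance `1` matches the tree's sticky potential
  `Literature.MathematicalPhysics.StatisticalMechanics.stickyPotential` and the Heitmann–Radin
  potential `V(r) = +∞ (r < 1), -1 (r = 1), 0 (r > 1)` as restated by De Luca–Friesecke.)
* `contactPairs x`, `numContacts x` — the touching pairs `i < j` and their number, i.e. the number
  of edges of the contact graph (Bezdek's contact number `C(𝒫)`).
* `contactNeighbors x i`, `coordination x i` — the contact neighbours of ball `i` and their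
  number (the degree of `i` in the contact graph); handshake
  `∑ i, coordination x i = 2 * numContacts x`.
* `maxContacts d N` — the largest contact number of a unit packing of `N` balls in `ℝᵈ`
  (Bezdek's `C(n)` for `d = 3`, Harborth's `c(n)` for `d = 2`); attained when `d ≥ 1`
  (`exists_numContacts_eq_maxContacts`), and an upper bound for every packing
  (`numContacts_le_maxContacts`).
* Link to the crystallization vocabulary of the tree (`interactionEnergy`, `stickyPotential`):
  on a unit packing the sticky energy is minus the contact number
  (`interactionEnergy_stickyPotential_of_isUnitPacking`), so the ground-state energy of `N` hard
  sticky spheres is `-(maxContacts d N)`.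

## Sources (for the notions; nothing is vendored as proved)

* K. Bezdek, *Contact numbers for congruent sphere packings in Euclidean 3-space*, Discrete
  Comput. Geom. 48 (2012) 298–309 (`Bezdek2012`), and the survey section "The Contact Number
  Problem of Unit Sphere Packings" in *Selected Open Problems in Discrete Geometry and
  Optimization*, Fields Inst. Commun. 69 (2013), §2.1 (contact graph, `C(𝒫)`, `C(n)`).
* H. Harborth, *Lösung zu Problem 664A*, Elem. Math. 29 (1974) 14–15 (`Harborth1974`): `c(n)`.
* R. C. Heitmann, C. Radin, *The ground state for sticky disks*, J. Stat. Phys. 22 (1980) 281–287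
  (`HeitmannRadin1980`): sticky potential, energy `= -`(number of bonds).

## Design notes

* Labelled configurations `Fin N → EuclideanSpace ℝ (Fin d)` (as in
  `Literature/MathematicalPhysics/StatisticalMechanics/Crystallization.lean`), not point sets:
  the cell's enumeration engines and the LP bridge (`LocalLP/Certificate.lean`) count balls by
  label. A unit packing is automatically injective (`IsUnitPacking.injective`).
* `maxContacts` is a `sSup` in `ℕ`; the set of contact numbers is bounded by `N²`
  (`numContacts_le_sq`) and non-empty when `d ≥ 1` (collinear chain) or `N ≤ 1`; for `d = 0`,
  `N ≥ 2` there is no packing and the junk value is `0` (documented, never used).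
* The 3-dimensional, radius-`1` contact count `Literature.Barriers.AtomisticToContinuum.contactNumber`
  of the barrier catalogue is the special case `d = 3` after scaling by `2`; it is not imported here
  (the venture needs `d = 2` and `d = 3` through one definition).
-/

noncomputable section

open scoped BigOperators
open Finset

namespace Summit.Ventures.Crystal3D

open Literature.MathematicalPhysics.StatisticalMechanics (interactionEnergy stickyPotential
  interactionEnergy_stickyPotential sum_ite_dist_lt_one_eq_zero_iff)

variable {d N : ℕ}

/-! ## Unit packings -/

/-- A **unit packing**: a labelled configuration of `N` centres of hard spheres of diameter `1` in
`ℝᵈ` — distinct balls have centres at distance `≥ 1` (contact = distance exactly `1`). -/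
def IsUnitPacking (x : Fin N → EuclideanSpace ℝ (Fin d)) : Prop :=
  Pairwise fun i j => 1 ≤ dist (x i) (x j)

namespace IsUnitPacking

variable {x : Fin N → EuclideanSpace ℝ (Fin d)}

/-- In a unit packing distinct balls have centres at distance `≥ 1`. -/
theorem one_le_dist (hx : IsUnitPacking x) {i j : Fin N} (h : i ≠ j) : 1 ≤ dist (x i) (x j) :=
  hx h

/-- A unit packing is an injective configuration (distinct labels, distinct centres). -/
theorem injective (hx : IsUnitPacking x) : Function.Injective x := by
  intro i j hij
  by_contra h
  have h1 := hx.one_le_dist h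
  rw [hij, dist_self] at h1
  exact absurd h1 (by norm_num)

/-- A sub-configuration (relabelling along an injective map) of a unit packing is a unit
packing. -/
theorem comp {M : ℕ} (hx : IsUnitPacking x) {f : Fin M → Fin N} (hf : Function.Injective f) :
    IsUnitPacking (x ∘ f) :=
  fun _ _ h => hx (hf.ne h)

end IsUnitPacking

/-- With at most one ball every configuration is a unit packing. -/
theorem isUnitPacking_of_subsingleton [Subsingleton (Fin N)]
    (x : Fin N → EuclideanSpace ℝ (Fin d)) : IsUnitPacking x :=
  fun i j h => absurd (Subsingleton.elim i j) h

/-! ## Contacts -/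

/-- The **contact pairs** of a configuration: the pairs of labels `i < j` whose centres are at
distance exactly `1` (the edges of the contact graph). -/
def contactPairs (x : Fin N → EuclideanSpace ℝ (Fin d)) : Finset (Fin N × Fin N) :=
  univ.filter fun p => p.1 < p.2 ∧ dist (x p.1) (x p.2) = 1

/-- The **contact number** `C(x)`: the number of touching pairs (edges of the contact graph). For
sticky spheres the energy of a packing is `-C(x)`. -/
def numContacts (x : Fin N → EuclideanSpace ℝ (Fin d)) : ℕ :=
  (contactPairs x).card

/-- The **contact neighbours** of ball `i`: the balls `j ≠ i` touching it. -/
def contactNeighbors (x : Fin N → EuclideanSpace ℝ (Fin d)) (i : Fin N) : Finset (Fin N) :=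
  univ.filter fun j => j ≠ i ∧ dist (x i) (x j) = 1

/-- The **coordination number** of ball `i`: its number of contacts (degree in the contact
graph). -/
def coordination (x : Fin N → EuclideanSpace ℝ (Fin d)) (i : Fin N) : ℕ :=
  (contactNeighbors x i).card

variable (x : Fin N → EuclideanSpace ℝ (Fin d))

/-- Membership in the contact pairs. -/
@[simp] theorem mem_contactPairs {p : Fin N × Fin N} :
    p ∈ contactPairs x ↔ p.1 < p.2 ∧ dist (x p.1) (x p.2) = 1 := by
  simp [contactPairs]

/-- Membership in the contact neighbours. -/
@[simp] theorem mem_contactNeighbors {i j : Fin N} :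
    j ∈ contactNeighbors x i ↔ j ≠ i ∧ dist (x i) (x j) = 1 := by
  simp [contactNeighbors]

/-- Contact is symmetric. -/
theorem mem_contactNeighbors_comm {i j : Fin N} :
    j ∈ contactNeighbors x i ↔ i ∈ contactNeighbors x j := by
  simp only [mem_contactNeighbors, dist_comm (x i) (x j), ne_comm]

/-- A ball is not its own contact neighbour. -/
theorem not_mem_contactNeighbors_self (i : Fin N) : i ∉ contactNeighbors x i := by
  simp

/-- The contact number is at most `N²` (crude bound; used only for boundedness). -/
theorem numContacts_le_sq : numContacts x ≤ N ^ 2 := by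
  calc numContacts x ≤ (univ : Finset (Fin N × Fin N)).card := card_filter_le _ _
    _ = N ^ 2 := by simp [sq]

/-- The coordination number of a ball is at most `N - 1`. -/
theorem coordination_le (i : Fin N) : coordination x i ≤ N - 1 := by
  have h : contactNeighbors x i ⊆ univ.erase i := by
    intro j hj
    exact mem_erase.2 ⟨((mem_contactNeighbors x).1 hj).1, mem_univ _⟩
  calc coordination x i ≤ (univ.erase i).card := card_le_card h
    _ = N - 1 := by simp [card_erase_of_mem]

/-- **Handshake.** The coordination numbers sum to twice the contact number:
`∑ i, deg(i) = 2 · C(x)`. -/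
theorem sum_coordination_eq : ∑ i, coordination x i = 2 * numContacts x := by
  classical
  -- ordered contact pairs, split by orientation
  set S : Finset (Fin N × Fin N) := univ.filter fun p => p.2 ≠ p.1 ∧ dist (x p.1) (x p.2) = 1
    with hS
  have hsum : ∑ i, coordination x i = S.card := by
    rw [hS, card_filter, Fintype.sum_prod_type]
    refine sum_congr rfl fun i _ => ?_
    rw [coordination, contactNeighbors, card_filter]
  have hsplit : S = (S.filter fun p => p.1 < p.2) ∪ (S.filter fun p => p.2 < p.1) := by
    ext p
    simp only [mem_union, mem_filter, hS, mem_univ, true_and]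
    constructor
    · rintro ⟨hne, hd⟩
      rcases lt_or_gt_of_ne hne with h | h
      · exact Or.inr ⟨⟨hne, hd⟩, h⟩
      · exact Or.inl ⟨⟨hne, hd⟩, h⟩
    · rintro (⟨h, -⟩ | ⟨h, -⟩) <;> exact h
  have hdisj : Disjoint (S.filter fun p => p.1 < p.2) (S.filter fun p => p.2 < p.1) := by
    rw [disjoint_filter]
    intro p _ h
    exact not_lt.2 h.le
  have h1 : (S.filter fun p => p.1 < p.2) = contactPairs x := by
    ext p
    simp only [mem_filter, hS, mem_univ, true_and, mem_contactPairs]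
    constructor
    · rintro ⟨⟨-, hd⟩, hlt⟩; exact ⟨hlt, hd⟩
    · rintro ⟨hlt, hd⟩; exact ⟨⟨(ne_of_lt hlt).symm, hd⟩, hlt⟩
  have h2 : (S.filter fun p => p.2 < p.1) = (contactPairs x).map
      ⟨Prod.swap, Prod.swap_injective⟩ := by
    ext p
    simp only [mem_filter, hS, mem_univ, true_and, mem_map, Function.Embedding.coeFn_mk,
      mem_contactPairs, Prod.exists, Prod.swap_prod_mk]
    constructor
    · rintro ⟨⟨-, hd⟩, hlt⟩
      exact ⟨p.2, p.1, ⟨hlt, by rw [dist_comm]; exact hd⟩, by simp⟩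
    · rintro ⟨a, b, ⟨hlt, hd⟩, rfl⟩
      exact ⟨⟨(ne_of_lt hlt), by rw [dist_comm]; exact hd⟩, hlt⟩
  rw [hsum, hsplit, card_union_of_disjoint hdisj, h1, h2, card_map, numContacts, two_mul]

/-! ## The maximal contact number `C(n)` -/

/-- The set of contact numbers of unit packings of `N` balls in `ℝᵈ`. -/
def contactNumbers (d N : ℕ) : Set ℕ :=
  {k | ∃ x : Fin N → EuclideanSpace ℝ (Fin d), IsUnitPacking x ∧ numContacts x = k}

/-- **The maximal contact number** `C(N)` of `N` hard unit-diameter spheres in `ℝᵈ`: the largest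
number of touching pairs in a unit packing of `N` balls (Bezdek's `C(n)` in `d = 3`, Harborth's
`c(n)` in `d = 2`). The sticky-sphere ground-state energy of `N` particles is `-C(N)`. (A supremum
in `ℕ`: attained when `d ≥ 1`; junk value `0` for `d = 0`, `N ≥ 2`, where no packing exists.) -/
def maxContacts (d N : ℕ) : ℕ :=
  sSup (contactNumbers d N)

/-- The set of contact numbers is bounded (by `N²`). -/
theorem bddAbove_contactNumbers (d N : ℕ) : BddAbove (contactNumbers d N) :=
  ⟨N ^ 2, by rintro k ⟨x, -, rfl⟩; exact numContacts_le_sq x⟩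

variable {x}

/-- Every unit packing has at most `C(N)` contacts. -/
theorem numContacts_le_maxContacts (hx : IsUnitPacking x) : numContacts x ≤ maxContacts d N :=
  le_csSup (bddAbove_contactNumbers d N) ⟨x, hx, rfl⟩

/-- The collinear chain `0, e, 2e, …` (spacing `1` along the first axis): a unit packing in every
dimension `d ≥ 1`, witnessing that packings exist. -/
def chainConfig (hd : 0 < d) (N : ℕ) : Fin N → EuclideanSpace ℝ (Fin d) :=
  fun i => EuclideanSpace.single (⟨0, hd⟩ : Fin d) ((i : ℕ) : ℝ)

/-- Distances in the collinear chain are the integer label differences. -/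
theorem dist_chainConfig (hd : 0 < d) (i j : Fin N) :
    dist (chainConfig hd N i) (chainConfig hd N j) = |((i : ℕ) : ℝ) - ((j : ℕ) : ℝ)| := by
  simp [chainConfig, PiLp.dist_single_same, Real.dist_eq]

/-- The collinear chain is a unit packing. -/
theorem isUnitPacking_chainConfig (hd : 0 < d) (N : ℕ) : IsUnitPacking (chainConfig hd N) := by
  intro i j hij
  rw [dist_chainConfig]
  have h : ((i : ℕ) : ℝ) ≠ ((j : ℕ) : ℝ) := by
    exact_mod_cast fun h => hij (Fin.ext h)
  rcases lt_or_gt_of_ne h with hlt | hlt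
  · have : ((i : ℕ) : ℝ) + 1 ≤ ((j : ℕ) : ℝ) := by exact_mod_cast (Nat.cast_lt.1 hlt : (i:ℕ) < j)
    rw [abs_of_neg (by linarith)]; linarith
  · have : ((j : ℕ) : ℝ) + 1 ≤ ((i : ℕ) : ℝ) := by exact_mod_cast (Nat.cast_lt.1 hlt : (j:ℕ) < i)
    rw [abs_of_pos (by linarith)]; linarith

/-- In dimension `d ≥ 1` unit packings of `N` balls exist, so the set of contact numbers is
non-empty. -/
theorem contactNumbers_nonempty (hd : 0 < d) (N : ℕ) : (contactNumbers d N).Nonempty :=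
  ⟨_, chainConfig hd N, isUnitPacking_chainConfig hd N, rfl⟩

/-- `C(N)` is attained: in dimension `d ≥ 1` some unit packing of `N` balls has exactly
`maxContacts d N` contacts. -/
theorem exists_numContacts_eq_maxContacts (hd : 0 < d) (N : ℕ) :
    ∃ x : Fin N → EuclideanSpace ℝ (Fin d), IsUnitPacking x ∧ numContacts x = maxContacts d N :=
  Nat.sSup_mem (contactNumbers_nonempty hd N) (bddAbove_contactNumbers d N)

/-- `C(N)` is the least upper bound: if every unit packing of `N` balls in `ℝᵈ` (`d ≥ 1`) has at
most `B` contacts then `C(N) ≤ B`. -/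
theorem maxContacts_le (hd : 0 < d) {B : ℕ}
    (h : ∀ x : Fin N → EuclideanSpace ℝ (Fin d), IsUnitPacking x → numContacts x ≤ B) :
    maxContacts d N ≤ B := by
  obtain ⟨x, hx, hxe⟩ := exists_numContacts_eq_maxContacts hd N
  exact hxe ▸ h x hx

/-- A witness gives a lower bound: a unit packing with `k` contacts shows `k ≤ C(N)`. -/
theorem le_maxContacts_of_witness {k : ℕ} (hx : IsUnitPacking x) (hk : numContacts x = k) :
    k ≤ maxContacts d N :=
  hk ▸ numContacts_le_maxContacts hx

/-! ## Sticky energy of a packing = minus its contact number -/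

/-- On a unit packing the sticky energy (tree potential `stickyPotential`: `1` below distance `1`,
`-1` at distance `1`, `0` beyond) is minus the contact number: `𝓔(x) = -C(x)`. This is the
Heitmann–Radin energy of a hard sticky-sphere configuration (the hard core is respected by a
packing, so the finite penalty of `stickyPotential` never fires). -/
theorem interactionEnergy_stickyPotential_of_isUnitPacking (hx : IsUnitPacking x) :
    interactionEnergy stickyPotential x = -(numContacts x : ℝ) := by
  rw [interactionEnergy_stickyPotential,
    (sum_ite_dist_lt_one_eq_zero_iff x).2 fun i j h => hx h, zero_sub]
  congr 1
  -- the double sum over `i`, `j > i` of the indicator of contact is the number of contact pairs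
  rw [numContacts, contactPairs, card_filter]
  push_cast
  rw [Fintype.sum_prod_type]
  refine sum_congr rfl fun i _ => ?_
  rw [← Finset.sum_filter_add_sum_filter_not univ (fun j => j ∈ Finset.Ioi i)]
  have h0 : ∑ j ∈ univ.filter (fun j => ¬ j ∈ Finset.Ioi i),
      (if i < j ∧ dist (x i) (x j) = 1 then (1 : ℝ) else 0) = 0 := by
    refine sum_eq_zero fun j hj => ?_
    rw [mem_filter, Finset.mem_Ioi] at hj
    rw [if_neg fun h => hj.2 h.1]
  rw [h0, add_zero, Finset.filter_mem_eq_inter, Finset.univ_inter]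
  refine sum_congr rfl fun j hj => ?_
  rw [Finset.mem_Ioi] at hj
  simp [hj]

end Summit.Ventures.Crystal3D

end
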